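/-
Copyright (c) 2026. All rights reserved.
Released under Apache 2.0 license as described in the file LICENSE.
Authors: abc-iut cell, prover seat abc-iut-c312-5 (Cor. 3.12 sub-crew, gen 7).
-/
import Literature.IUT.LogVolume.TensorPacketContentExact
import Literature.IUT.LogVolume.TensorPacketContentSharp
import Literature.IUT.LogVolume.TensorPacketOrbitContent
import HarnessLib

/-!
# The per-summand (xi-f) inclusion «q-box ⊆ holomorphic hull of the (Ind2)-orbit of the Θ-box» decided EXACTLY
# by two one-factor invariants of each shell — inner and outer radius — and the differents

abc-iut cell, seat abc-iut-c312-5 (D-0079 sub-cell R-W «WINDOW Θ-SIDE INEQUALITY», lane U, task T2; part 3 over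
`TensorPacketConductor` / `TensorPacketContentExact`).  PROOF-ONLY file (no definitions, no named `Prop` facts);
classical lattice algebra over the cell's REAL definitions (`PacketAlgebra`, `normalizedPacket` = `(R_I)^∼`,
`logPacket` = `log_p(R_I^×)`, `packetHull` = the `(R_I)^∼`-span = [IUTchIII] Rmk. 3.9.5's holomorphic hull on
relatively compact regions, `indTwo` = Dupuy–Hilado's (Ind2) `Aut_{ℚ_p}(V : log_p(R_I^×))`, `dEquiv` = `ψ`).

For each factor `k_i` fix `c^in_i` spanning the LARGEST ball inside `log_p(R_i^×)` (`ρ_in := ‖c^in_i‖`, the inner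
radius) and `c^out_i ∈ log_p(R_i^×)` of LARGEST norm (`ρ_out := ‖c^out_i‖`, the outer radius; exists by
abc-iut-w6-d018's `exists_norm_le_norm_of_mem_logUnits`).  Then:

* §6 `packetHull_zpow_smul_logPacket_eq` — `hull(p^m·log_p(R_I^×)) = (p^m·⊗c^out_i)·(R_I)^∼` (abc-iut-w6-d018's
  `exists_mem_integerPacket_of_mem_logPacket_of_dominates` and `purePacket_smul_normalizedPacket_subset_packetHull_logPacket`);
* §7 `iota_smul_normalizedPacket_subset_packetHull_zpow_smul_logPacket_iff` — a slot box `ι_b(t)·(R_I)^∼` lies in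
  `hull(p^m·log_p(R_I^×))` iff `p^m·‖t‖ ≤ ∏_i ρ_out` (compare coordinates under `ψ`; `(R_I)^∼` is the unit polydisc);
* §8 **`iota_smul_subset_packetHull_orbit_iota_smul_iff`** — for a Θ-box `M_Θ = ι_b(t_Θ)·(R_I)^∼` (`t_Θ ≠ 0`) and a
  q-box `M_q = ι_{b'}(t_q)·(R_I)^∼`:
  `M_q ⊆ hull(⋃_{γ ∈ Ind2} γ·M_Θ) ⟺ ∀ m ∈ ℤ, (∀ J, p^m·‖t_Θ‖ ≤ p^{−(d_I − d_{L_J})}·∏_i ρ_in) → p^m·‖t_q‖ ≤ ∏_i ρ_out`,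
  i.e. with the CONTENT `m_Θ = ⌊v_p(t_Θ) − (d_I − min_J d_{L_J}) − Σ_i α_i⌋` (`ρ_in = p^{−α_i}`, part 2) of the Θ-box:
  **`v_p(t_q) + Σ_i β_i ≥ m_Θ`** (`ρ_out = p^{−β_i}`).  The hull of the orbit is abc-iut-w5-d180's
  `hull(⋃γ·M) = hull(p^{m_Θ}·log_p(R_I^×))` (`TensorPacketOrbitContent.exists_packetHull_orbit_eq_zpow`); by
  `TensorPacketFactorwiseOrbitSpan.packetHull_factorwiseOrbit_eq_packetHull_orbit` the FACTORWISE (Ind2) of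
  [IUTchIII] Thm. 3.11 (i) — the cell's typed (Ind2) at the real settings — has the same hull.

READING (neutral).  At a TAME factor `log_p(R_i^×) = 𝔪_i`, `α_i = β_i = 1/e_i`, and for the diagonal packet of one
Galois field (`d_I − min_J d_{L_J} = j·(e−1)/e`) the criterion is abc-iut-w5-d180's exact tame dichotomy
`m_q ≥ e·⌊(m_Θ−1)/e⌋ + 1 − j·(e−1)` (`Cor312LicenceExplicitDepthExact`).  At a WILD factor (`e_i ≥ p − 1`, where
`log_p(R_i^×)` is no ball) the two radii differ and BOTH enter: the whole «undecided window» of the R-W table at a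
packet is the pair `(r_in, r_out)` of the genuine completions — classical invariants of `log_p` on `𝒪^×_{K_w}`.
HONEST SCOPE: the per-summand hull inclusion is a STRONGER-THAN-PRINT set-level reading of [IUTchIII] Cor. 3.12
Step (xi-f); the (Ind2) and the hull are the tree's typings of disputed-corpus constructions; nothing here bears on
the printed GLOBAL inequality; no side taken on [IUTchIII] Cor. 3.12 or on any author.
[cite: Mochizuki2012, IUTchIV Prop. 1.1 p. 9, Prop. 1.2 (i)(ii) p. 10; IUTchIII Rmk. 3.9.5 (i) p. 127]
[cite: DupuyHilado2025, §3.7, §4.9, §4.12] [cite: WeilBNT1967, Ch. II §2, Th. 1–2] [claim: Mochizuki2012, status: disputed].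
-/

noncomputable section

open Set Module Function
open scoped Pointwise TensorProduct NormedField nonZeroDivisors

namespace Literature.IUT.LogVolume

open Literature.NumberTheory.GaloisRepresentations.Ultrametric

variable (p : ℕ) [Fact p.Prime]
variable {I : Type} [Fintype I] [DecidableEq I] [Nonempty I]
variable (k : I → Type) [∀ i, NontriviallyNormedField (k i)] [∀ i, NormedAlgebra ℚ_[p] (k i)]
  [∀ i, IsUltrametricDist (k i)] [∀ i, ProperSpace (k i)]

/-! ## 6. The hull of `p^m · log_p(R_I^×)` is the translate `(p^m·⊗c^out)·(R_I)^∼` -/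

/-- An element all of whose `ψ`-coordinates have norm `≤ 1` lies in `(R_I)^∼` (`ψ((R_I)^∼)` is the unit polydisc).
[cite: Mochizuki2012, IUTchIV Prop. 1.4 (i) p. 13] -/
private theorem mem_normalizedPacket_of_forall_norm_dEquiv_le' {s : PacketAlgebra p k}
    (hs : ∀ J, ‖dEquiv p k s J‖ ≤ 1) : s ∈ normalizedPacket p k := by
  have ha : dEquiv p k s ∈ integralElements (DFac p k) := by
    rw [← polydisc_one_eq_integralElements, mem_polydisc]; exact hs
  have h := symm_mem_normalizedPacket p k (DFac p k) (dEquiv p k) ha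
  rwa [AlgEquiv.symm_apply_apply] at h

/-- `‖ψ_J(s)‖ ≤ 1` for `s ∈ (R_I)^∼`. [cite: Mochizuki2012, IUTchIV Prop. 1.4 (i) p. 13] -/
private theorem norm_dEquiv_le_one_of_mem_normalizedPacket'' {s : PacketAlgebra p k}
    (hs : s ∈ normalizedPacket p k) (J : DIdx p k) : ‖dEquiv p k s J‖ ≤ 1 := by
  have h : dEquiv p k s ∈ dEquiv p k '' (normalizedPacket p k : Set (PacketAlgebra p k)) :=
    Set.mem_image_of_mem _ hs
  rw [image_normalizedPacket_eq_coe, coe_piUnitBallStructure, mem_polydisc] at h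
  exact h J

/-- **Translates compared by coordinates**: for `y` with all `ψ_J(y) ≠ 0`,
`x·(R_I)^∼ ⊆ y·(R_I)^∼ ⟺ ∀ J, ‖ψ_J(x)‖ ≤ ‖ψ_J(y)‖`. [cite: DupuyHilado2025, §4.12] -/
theorem smul_normalizedPacket_subset_smul_normalizedPacket_iff {x y : PacketAlgebra p k}
    (hy : ∀ J, dEquiv p k y J ≠ 0) :
    x • (normalizedPacket p k : Set (PacketAlgebra p k)) ⊆ y • (normalizedPacket p k : Set (PacketAlgebra p k)) ↔
      ∀ J, ‖dEquiv p k x J‖ ≤ ‖dEquiv p k y J‖ := by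
  constructor
  · intro h J
    have hx : x ∈ y • (normalizedPacket p k : Set (PacketAlgebra p k)) := by
      refine h ⟨1, (normalizedPacket p k).one_mem, ?_⟩
      change x • (1 : PacketAlgebra p k) = x
      rw [smul_eq_mul, mul_one]
    obtain ⟨s, hs, rfl⟩ := Set.mem_smul_set.mp hx
    rw [smul_eq_mul, map_mul, Pi.mul_apply, norm_mul]
    exact mul_le_of_le_one_right (norm_nonneg _) (norm_dEquiv_le_one_of_mem_normalizedPacket'' p k hs J)
  · intro h
    -- `y` is invertible in `V ≅ ∏ L_J`; `s := y⁻¹ x ∈ (R_I)^∼`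
    set yinv : PacketAlgebra p k := (dEquiv p k).symm (fun J => (dEquiv p k y J)⁻¹) with hyinv
    have hyy : y * yinv = 1 := by
      apply (dEquiv p k).injective
      rw [map_mul, hyinv, AlgEquiv.apply_symm_apply, map_one]
      funext J
      rw [Pi.mul_apply, Pi.one_apply, mul_inv_cancel₀ (hy J)]
    have hs : yinv * x ∈ normalizedPacket p k := by
      refine mem_normalizedPacket_of_forall_norm_dEquiv_le' p k fun J => ?_
      rw [map_mul, Pi.mul_apply, hyinv, AlgEquiv.apply_symm_apply, norm_mul, norm_inv,
        inv_mul_le_iff₀ (norm_pos_iff.mpr (hy J)), mul_one]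
      exact h J
    rintro _ ⟨r, hr, rfl⟩
    refine Set.mem_smul_set.mpr ⟨yinv * x * r, mul_mem_normalizedPacket p k hs hr, ?_⟩
    change y * (yinv * x * r) = x * r
    rw [← mul_assoc, ← mul_assoc, hyy, one_mul]

omit [Fintype I] [DecidableEq I] [Nonempty I] [∀ i, IsUltrametricDist (k i)] [∀ i, ProperSpace (k i)] in
/-- **The hull of `p^m · log_p(R_I^×)`**: for `c^out_i ∈ log_p(R_i^×)` of largest norm,
`hull(p^m·log_p(R_I^×)) = (p^m·⊗c^out_i)·(R_I)^∼` — `log_p(R_I^×) ⊆ ⊗c^out·R_I` (abc-iut-w6-d018) and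
`⊗c^out·(R_I)^∼ ⊆ hull(log_p(R_I^×))`. [cite: Mochizuki2012, IUTchIV Prop. 1.2 (i) p. 10] [cite: DupuyHilado2025, §4.12] -/
theorem packetHull_zpow_smul_logPacket_eq {c : Π i, k i} (hc0 : ∀ i, c i ≠ 0) (hcΛ : ∀ i, c i ∈ logUnits (k i))
    (hdom : ∀ i, ∀ z ∈ logUnits (k i), ‖z‖ ≤ ‖c i‖) (m : ℤ) :
    packetHull p k (((p : ℚ_[p]) ^ m) • (logPacket p k : Set (PacketAlgebra p k))) =
      (ppow p k m * purePacket p k c) • (normalizedPacket p k : Set (PacketAlgebra p k)) := by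
  apply Set.Subset.antisymm
  · refine packetHull_subset_smul_normalizedPacket p k ?_
    rintro _ ⟨w, hw, rfl⟩
    obtain ⟨a, ha, rfl⟩ := exists_mem_integerPacket_of_mem_logPacket_of_dominates p k hc0 hdom hw
    refine Set.mem_smul_set.mpr ⟨a, integerPacket_le_normalizedPacket p k ha, ?_⟩
    change ppow p k m * purePacket p k c * a = ((p : ℚ_[p]) ^ m) • (purePacket p k c * a)
    rw [mul_assoc, ppow_mul_eq_smul]
  · rintro _ ⟨r, hr, rfl⟩
    show (ppow p k m * purePacket p k c) • r ∈
      packetHull p k (((p : ℚ_[p]) ^ m) • (logPacket p k : Set (PacketAlgebra p k)))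
    rw [packetHull_apply, SetLike.mem_coe, smul_eq_mul, mul_comm]
    refine Submodule.smul_mem _ (⟨r, hr⟩ : normalizedPacket p k) (Submodule.subset_span ?_)
    refine ⟨purePacket p k c, AddSubgroup.subset_closure ⟨c, hcΛ, rfl⟩, ?_⟩
    change ((p : ℚ_[p]) ^ m) • purePacket p k c = ppow p k m * purePacket p k c
    rw [ppow_mul_eq_smul]

/-! ## 7. A slot box inside `hull(p^m · log_p(R_I^×))`: the outer radii decide -/

/-- **`ι_b(t)·(R_I)^∼ ⊆ hull(p^m·log_p(R_I^×)) ⟺ p^m·‖t‖ ≤ ∏_i ρ_out`** (`ρ_out = ‖c^out_i‖`, the largest norm on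
`log_p(R_i^×)`): both sides are translates of `(R_I)^∼`, compared coordinatewise under `ψ` (`‖ψ_J(ι_b t)‖ = ‖t‖`,
`‖ψ_J(p^m·⊗c^out)‖ = p^{−m}·∏‖c^out_i‖` at every `J`). [cite: DupuyHilado2025, §3.7, §4.12] -/
theorem iota_smul_normalizedPacket_subset_packetHull_zpow_smul_logPacket_iff {c : Π i, k i} (hc0 : ∀ i, c i ≠ 0)
    (hcΛ : ∀ i, c i ∈ logUnits (k i)) (hdom : ∀ i, ∀ z ∈ logUnits (k i), ‖z‖ ≤ ‖c i‖) (b : I) (t : k b) (m : ℤ) :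
    iota p k b t • (normalizedPacket p k : Set (PacketAlgebra p k)) ⊆
        packetHull p k (((p : ℚ_[p]) ^ m) • (logPacket p k : Set (PacketAlgebra p k))) ↔
      (p : ℝ) ^ m * ‖t‖ ≤ ∏ i, ‖c i‖ := by
  have hp : p.Prime := Fact.out
  have hp0 : (0 : ℝ) < p := by exact_mod_cast hp.pos
  have hy : ∀ J, dEquiv p k (ppow p k m * purePacket p k c) J ≠ 0 := fun J => by
    rw [map_mul, Pi.mul_apply]
    exact mul_ne_zero (by rw [← norm_pos_iff, norm_psi_ppow_apply]; positivity)
      (dEquiv_purePacket_ne_zero p k hc0 J)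
  have hnorm : ∀ J, ‖dEquiv p k (ppow p k m * purePacket p k c) J‖ = (p : ℝ) ^ (-m) * ∏ i, ‖c i‖ := fun J => by
    rw [map_mul, Pi.mul_apply, norm_mul, norm_psi_ppow_apply, psi_purePacket_apply, norm_prod]
    simp_rw [norm_factorEmb]
  rw [packetHull_zpow_smul_logPacket_eq p k hc0 hcΛ hdom, smul_normalizedPacket_subset_smul_normalizedPacket_iff p k hy]
  simp_rw [norm_dEquiv_iota, hnorm]
  rw [forall_const, zpow_neg, ← div_eq_inv_mul, le_div_iff₀ (zpow_pos hp0 _), mul_comm]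

/-! ## 8. The per-summand (xi-f) inclusion, exactly -/

/-- **THE q-BOX LIES IN THE HULL OF THE (Ind2)-ORBIT OF THE Θ-BOX — EXACTLY WHEN.**  With the largest inner balls
`c^in_i·R_i ⊆ log_p(R_i^×)` (radii `ρ_in`) and elements `c^out_i ∈ log_p(R_i^×)` of largest norm (`ρ_out`), a Θ-box
`M_Θ = ι_b(t_Θ)·(R_I)^∼` (`t_Θ ≠ 0`) and a q-box `M_q = ι_{b'}(t_q)·(R_I)^∼`:
`M_q ⊆ hull(⋃_{γ ∈ Ind2} γ·M_Θ) ⟺ ∀ m, (∀ J, p^m·‖t_Θ‖ ≤ p^{−(d_I − d_{L_J})}·∏ρ_in) → p^m·‖t_q‖ ≤ ∏ρ_out` — i.e. iff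
`p^{m_Θ}·‖t_q‖ ≤ ∏ρ_out` for the content `m_Θ` of the Θ-box (the largest admissible `m`; part 2).  Proof:
`hull(⋃γ·M_Θ) = hull(p^{m_Θ}·log_p(R_I^×))` (abc-iut-w5-d180), §7, and maximality of the content.
[cite: DupuyHilado2025, §4.9, §4.12] [cite: Mochizuki2012, IUTchIV Prop. 1.1 p. 9, Prop. 1.2 (i)(ii) p. 10] -/
theorem iota_smul_subset_packetHull_orbit_iota_smul_iff {cin cout : Π i, k i} (hin0 : ∀ i, cin i ≠ 0)
    (hin : ∀ i (o : k i), ‖o‖ ≤ 1 → cin i * o ∈ logUnits (k i))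
    (hmax : ∀ i, ∃ (ϖ : (k i)ˣ) (w : k i), IsUniformizer ϖ ∧ w ∉ logUnits (k i) ∧ ‖w‖ * ‖(ϖ : k i)‖ ≤ ‖cin i‖)
    (hout0 : ∀ i, cout i ≠ 0) (houtΛ : ∀ i, cout i ∈ logUnits (k i))
    (hdom : ∀ i, ∀ z ∈ logUnits (k i), ‖z‖ ≤ ‖cout i‖)
    (b b' : I) {tΘ : k b} (htΘ : tΘ ≠ 0) (tq : k b') :
    iota p k b' tq • (normalizedPacket p k : Set (PacketAlgebra p k)) ⊆
        packetHull p k (⋃ g : indTwo p k, g • (iota p k b tΘ • (normalizedPacket p k : Set (PacketAlgebra p k)))) ↔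
      ∀ m : ℤ, (∀ J, (p : ℝ) ^ m * ‖tΘ‖ ≤ (p : ℝ) ^ (-(dSum p k - differentOrd p (DFac p k J))) * ∏ i, ‖cin i‖) →
        (p : ℝ) ^ m * ‖tq‖ ≤ ∏ i, ‖cout i‖ := by
  have hp : p.Prime := Fact.out
  have hp1 : (1 : ℝ) < p := by exact_mod_cast hp.one_lt
  have hp0 : (0 : ℝ) < p := by linarith
  set M : Set (PacketAlgebra p k) := iota p k b tΘ • (normalizedPacket p k : Set (PacketAlgebra p k)) with hM
  -- the Θ-box is bounded and contains the nonzero vector `ι_b(t_Θ)`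
  have hMb : IsPsiBounded p k M := isPsiBounded_smul_normalizedPacket p k _
  have hM0 : ∃ x ∈ M, x ≠ 0 := by
    refine ⟨iota p k b tΘ, ⟨1, (normalizedPacket p k).one_mem, by
      change iota p k b tΘ • (1 : PacketAlgebra p k) = _; rw [smul_eq_mul, mul_one]⟩, fun h0 => ?_⟩
    obtain ⟨J⟩ := (inferInstance : Nonempty (DIdx p k))
    exact dEquiv_iota_ne_zero p k b htΘ J (by rw [h0, map_zero, Pi.zero_apply])
  -- its content `m₀` and the hull of its orbit
  obtain ⟨m₀, hm₀, hm₀1, hhull⟩ := exists_packetHull_orbit_eq_zpow p k hMb hM0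
  have hadm : ∀ m : ℤ, M ⊆ ((p : ℚ_[p]) ^ m) • (logPacket p k : Set (PacketAlgebra p k)) ↔
      ∀ J, (p : ℝ) ^ m * ‖tΘ‖ ≤ (p : ℝ) ^ (-(dSum p k - differentOrd p (DFac p k J))) * ∏ i, ‖cin i‖ :=
    fun m => iota_smul_normalizedPacket_subset_zpow_smul_logPacket_iff p k hin0 hin hmax b tΘ m
  have hle : ∀ m : ℤ, M ⊆ ((p : ℚ_[p]) ^ m) • (logPacket p k : Set (PacketAlgebra p k)) → m ≤ m₀ := by
    intro m hm
    by_contra hlt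
    exact hm₀1 (hm.trans (zpow_smul_logPacket_anti p k (by omega)))
  rw [hhull, iota_smul_normalizedPacket_subset_packetHull_zpow_smul_logPacket_iff p k hout0 houtΛ hdom]
  constructor
  · intro h0 m hm
    have hmm₀ : m ≤ m₀ := hle m ((hadm m).mpr hm)
    calc (p : ℝ) ^ m * ‖tq‖ ≤ (p : ℝ) ^ m₀ * ‖tq‖ :=
          mul_le_mul_of_nonneg_right (zpow_le_zpow_right₀ hp1.le hmm₀) (norm_nonneg _)
      _ ≤ _ := h0
  · intro h
    exact h m₀ ((hadm m₀).mp hm₀)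

end Literature.IUT.LogVolume

end
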